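import Summits.QuantumFields.YangMills.Theorems.BalabanUVNodesN21AtKeyedRateHome

/-!
# YM-DAG node N21 (= NE7c) AT A KEYED RATE HOME ⊗ NODE U2, STAGE-FREE: the THRESHOLD width family of road I BY NAME — under node U2's output
# `Spine.NE4.U2Output D g₀ Cout θ₂` on a tuned window the band between the two runs' coupling-dependent thresholds of record is `≤ c₂·θ₂^j` RELATIVE TO
# EITHER RUN's OWN threshold (`c₂ = 2(1 + p₀∕log γ⁻²)γ²Cout`) — and NE7c's `ShellWeightBound` AT EXPLICIT CARRIERS with BOTH width families supplied by
# name: the variable width from N16's record decl at the home's NE3 layers (module 5), the threshold width from U2 (here)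

Track A of `YM-PLAN.md` (cell `pub-ymgap`, HUMAN RULING D-0062), node **N21**; R134 fan-out seat `pub-ymgap-dag-n21-d` (s2 = BY-NAME KNIT), generation 2,
module 6 — companion of module 5 `BalabanUVNodesN21AtKeyedRateHome` (p463475: `shellWeightBound_geometric_of_ne3Layers` took the threshold widths `τ ≤ c₂ϑ₂^j`
as hypotheses) and of the seat's g0 module `BalabanUVNodesN21ThresholdSyncAtRecord` (p455507: the band `|ε(g^{(K)}_j) − ε(g^{(K+1)}_{j+1})| ≤ (1 + p₀∕log γ⁻²)
γ²·Cout·θ₂^j·max(ε, ε′)` under `U2Output`).  THEOREMS ONLY: 0 `def`, 0 `sorry`, standard axioms; COUNT-NEUTRAL; `--supports` the K3 item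
`SpineGivenEndpointR11` (stmt-QuantumFields-19676).  Stage-free (no `Record1x` key imported); restate-immune (no Theses import).

WHAT IS PROVED ([folklore] real bookkeeping; node U2's output enters BY NAME, nothing of Bałaban's asserted).
* §1 `abs_sub_le_two_mul_left ∕ _right` — a band relative to the LARGER of two nonnegative thresholds with ratio `κ ≤ 1∕2` is a band of ratio `2κ` relative to
  EITHER threshold (the thresholds are then comparable within a factor 2).
* §2 `cout_nonneg_of_u2Output`; `abs_epsOfRecord_runs_sub_le_mul_left ∕ _right_of_u2Output` — under `U2Output D g₀ Cout θ₂`, `0 ≤ θ₂ ≤ 1`, both couplings at the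
  matched levels in the window `(0, γ]`, `γ < 1`, `0 ≤ ν.A₀`, and the WINDOW SMALLNESS `(1 + p₀∕log γ⁻²)·γ²·Cout ≤ 1∕2` (an asymptotic-freedom-type window
  clause: the left side is `O(γ²)`): `|ε(g^{(K)}_j) − ε(g^{(K+1)}_{j+1})| ≤ (2(1 + p₀∕log γ⁻²)γ²Cout)·θ₂^j·ε(g^{(K)}_j)` and the same with `ε(g^{(K+1)}_{j+1})`
  — p455507's band made relative to each run's OWN threshold of record.
* §3 `thresholdRate_left ∕ _right_of_u2Output` — THE THRESHOLD WIDTH FAMILY BY NAME: for a level-width sequence `τ` of a term ledger with the displayed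
  [dict-thr] clause «`τ j` is at most EVERY `x` with `|ε(g^{(K)}_j) − ε(g^{(K+1)}_{j+1})| ≤ x·ε(g^{(K)}_j)` (resp. `x·ε(g^{(K+1)}_{j+1})`) for all run lengths
  `K ≥ j`» and the couplings of every tuned run in the window (`box_and_pin_of_tuned`'s first clause): `∀ j, τ j ≤ c₂·θ₂^j` — the binder `hτA ∕ hτB` of module 5.
* §4 `shellWeightBound_geometric_of_ne3Layers_u2Output` — **NE7c's `ShellWeightBound` AT EXPLICIT CARRIERS WITH BOTH WIDTH FAMILIES BY NAME**: module 5's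
  `shellWeightBound_geometric_of_ne3Layers` with its threshold inputs `(hc₂, h₂, h₂′, hτA, hτB)` DISCHARGED from `U2Output` + the tuned window + the smallness
  + the two [dict-thr] clauses (§3); the variable-width inputs (N16's `N16At` at the layers, END letters, [dict] clauses), the ledgers, windows and `D ≤ D̄` stay
  displayed.  CONCLUSION: `∃ C ≥ 0`, `ShellWeightBound l₀ T A B shA shB (K ↦ C·(θ ∨ θ₂)^K)`.  At a keyed home the in-edge `h16` is `covRoot_of_attains` (module
  5 §5) and `U2Output` at the datum is node U2's knit (`N17KnitEdge` lineage) — one application each.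
* §5 `shellWeightBound_geometric_of_attains_u2Output` — §4 at ANY keyed home BY NAME: the in-edge N16 as the K4 stub `S_N16 RRec` for a home that ATTAINS the
  literals of a key-indexed NE3 reading (`covRoot_of_attains`), the window clause from `D.Tuned γ g g₀` (`box_and_pin_of_tuned`).

HONEST FRAMING (binding).  `U2Output` (node U2, NOT PRINTED: [Balaban1987RG1] p. 264 defers the β-function properties), the tuned window, the smallness clause,
`N16At` at the layers, the level ledgers ((M1) NOT PRINTED + [dict]), live windows, `D ≤ D̄`, END letters and every [dict]∕[dict-thr] clause are HYPOTHESES,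
displayed; readings residual (NODE O); NE7c is NOT PRINTED and NOT PROVED; **N21 is NOT discharged** (0∕1 at every record); typed 28∕28, discharged count
untouched; one finite four-torus programme at fixed `ε` — NOT ℝ⁴, NOT infinite volume, NOT OS, NOT a mass gap, NOT Clay.  No decl below carries a cite tag.
-/

set_option autoImplicit false

noncomputable section

open scoped BigOperators Matrix Matrix.Norms.L2Operator

namespace Summit.QuantumFields.YangMills.Theorems.N21AtKeyedRateHomeU2

open Literature.MathematicalPhysics.QuantumFieldTheory.Balaban1983to89
open Literature.MathematicalPhysics.QuantumFieldTheory.Balaban1983to89.T4Continuum (T4Family ULoop FiniteEpsData)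
open Literature.MathematicalPhysics.QuantumFieldTheory.Balaban1983to89.T4CouplingMatching (disc disc_nonneg)
open B7Prop1Explicit B7Prop2Explicit
open T4AveragingDeficitWall (Plane)
open T4IndicatorShell (ShellWeightBound)
open T4ShellMeasureLevels (LevelLedger LiveWindow)
open Summit.QuantumFields.BalabanUV.T4Continuum
open Summit.QuantumFields.BalabanUV.T4Continuum.Spine.NE4 (U2Output runFlow)
open MinimalActionSandwich (IsMinimiser)
open MinimalActionRate (Regular sfClass)
open MinimalActionRefine (RegularSup)
open AveragingDeficitDualResidual (dualC1 dualC2)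
open AveragingDeficitDerivWallProof (wallConst)
open YMDAG.UVSplit (N16At ne3OfRecord₁₁)
open Summit.QuantumFields.YangMills.BalabanUVNodes (N16AtRRec11.n16At_ne3OfRecord₁₁_iff N16AtKeyedHome.covRoot_of_attains)
open N21ThresholdSyncAtRecord (eps_nonneg abs_epsOfRecord_runs_sub_le_of_u2Output)
open N21AtKeyedRateHome (shellWeightBound_geometric_of_ne3Layers)
open Node00 (NE3Objects₁₁ Stage7Numerics epsOfRecord)

variable {N : ℕ} [NeZero N]

/-! ## §1 A band relative to the larger threshold with ratio `≤ 1∕2` is a band of twice the ratio relative to either threshold -/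

/-- `|a − b| ≤ κ·max(a, b)`, `0 ≤ a, b`, `0 ≤ κ ≤ 1∕2` ⇒ `|a − b| ≤ 2κ·a`. [folklore] -/
theorem abs_sub_le_two_mul_left {a b κ : ℝ} (ha : 0 ≤ a) (hb : 0 ≤ b) (hκ : 0 ≤ κ) (hκ2 : κ ≤ 1 / 2) (h : |a - b| ≤ κ * max a b) :
    |a - b| ≤ 2 * κ * a := by
  rcases le_total a b with hab | hba
  · rw [max_eq_right hab] at h
    have h1 : b - a ≤ κ * b := by rw [abs_sub_comm] at h; exact (le_abs_self _).trans h
    have hb2 : b ≤ 2 * a := by nlinarith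
    calc |a - b| ≤ κ * b := h
      _ ≤ κ * (2 * a) := mul_le_mul_of_nonneg_left hb2 hκ
      _ = 2 * κ * a := by ring
  · rw [max_eq_left hba] at h
    calc |a - b| ≤ κ * a := h
      _ ≤ 2 * κ * a := by nlinarith [mul_nonneg hκ ha]

/-- `|a − b| ≤ κ·max(a, b)`, `0 ≤ a, b`, `0 ≤ κ ≤ 1∕2` ⇒ `|a − b| ≤ 2κ·b`. [folklore] -/
theorem abs_sub_le_two_mul_right {a b κ : ℝ} (ha : 0 ≤ a) (hb : 0 ≤ b) (hκ : 0 ≤ κ) (hκ2 : κ ≤ 1 / 2) (h : |a - b| ≤ κ * max a b) :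
    |a - b| ≤ 2 * κ * b := by
  rw [abs_sub_comm] at h ⊢
  rw [max_comm] at h
  exact abs_sub_le_two_mul_left hb ha hκ hκ2 h

/-! ## §2 Node U2's output ⇒ the threshold band relative to each run's OWN threshold of record -/

section U2

variable {F : T4Family} {G : Type*} [GaugeGroup G] [MeasurableSpace G] [HaarData G]

/-- `U2Output D g₀ Cout θ` forces `0 ≤ Cout` (the discrepancy at `(K, j) = (0, 0)` is nonnegative and `≤ Cout·θ⁰`). [folklore] -/
theorem cout_nonneg_of_u2Output (D : FiniteEpsData F G) (g₀ : ℕ → ℝ) {Cout θ : ℝ} (hU2 : U2Output D g₀ Cout θ) : 0 ≤ Cout := by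
  obtain ⟨h0, h1⟩ := hU2 0 0 le_rfl
  simpa using h0.trans h1

/-- **THE THRESHOLD BAND RELATIVE TO RUN A's OWN THRESHOLD.**  Along the `K`-step and `(K+1)`-step tuned runs of a datum `D`, under node U2's output
`U2Output D g₀ Cout θ₂` (`0 ≤ θ₂ ≤ 1`), both couplings at the matched levels `j ≤ K`, `j + 1` in the window `(0, γ]`, `γ < 1`, `0 ≤ ν.A₀`, and the WINDOW
SMALLNESS `(1 + p₀∕log γ⁻²)·γ²·Cout ≤ 1∕2`: `|ε(g^{(K)}_j) − ε(g^{(K+1)}_{j+1})| ≤ (2(1 + p₀∕log γ⁻²)γ²Cout)·θ₂^j·ε(g^{(K)}_j)` — p455507's band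
(`abs_epsOfRecord_runs_sub_le_of_u2Output`, relative to the larger threshold) and §1. [folklore] -/
theorem abs_epsOfRecord_runs_sub_le_mul_left_of_u2Output (ν : Stage7Numerics) (hA₀ : 0 ≤ ν.A₀) (D : FiniteEpsData F G) (g₀ : ℕ → ℝ)
    {Cout θ₂ γ : ℝ} (hU2 : U2Output D g₀ Cout θ₂) (hθ0 : 0 ≤ θ₂) (hθ1 : θ₂ ≤ 1) (hγ1 : γ < 1)
    (hsmall : (1 + ν.p₀ / Real.log (γ ^ 2)⁻¹) * γ ^ 2 * Cout ≤ 1 / 2) {K j : ℕ} (hj : j ≤ K)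
    (hA : 0 < runFlow D g₀ K j) (hAγ : runFlow D g₀ K j ≤ γ)
    (hB : 0 < runFlow D g₀ (K + 1) (j + 1)) (hBγ : runFlow D g₀ (K + 1) (j + 1) ≤ γ) :
    |epsOfRecord ν (runFlow D g₀ K) j - epsOfRecord ν (runFlow D g₀ (K + 1)) (j + 1)| ≤
      (2 * ((1 + ν.p₀ / Real.log (γ ^ 2)⁻¹) * γ ^ 2 * Cout)) * θ₂ ^ j * epsOfRecord ν (runFlow D g₀ K) j := by
  have hband := abs_epsOfRecord_runs_sub_le_of_u2Output ν hA₀ D g₀ hU2 hγ1 hj hA hAγ hB hBγ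
  have hγ : 0 < γ := lt_of_lt_of_le hA hAγ
  have hlogγ : 0 < Real.log (γ ^ 2)⁻¹ := Real.log_pos ((one_lt_inv₀ (by positivity)).mpr (by nlinarith))
  have hCout : 0 ≤ Cout := cout_nonneg_of_u2Output D g₀ hU2
  have hc : 0 ≤ (1 + ν.p₀ / Real.log (γ ^ 2)⁻¹) * γ ^ 2 := by positivity
  have hθj : θ₂ ^ j ≤ 1 := pow_le_one₀ hθ0 hθ1
  have hκ : 0 ≤ (1 + ν.p₀ / Real.log (γ ^ 2)⁻¹) * γ ^ 2 * (Cout * θ₂ ^ j) := mul_nonneg hc (mul_nonneg hCout (pow_nonneg hθ0 j))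
  have hκ2 : (1 + ν.p₀ / Real.log (γ ^ 2)⁻¹) * γ ^ 2 * (Cout * θ₂ ^ j) ≤ 1 / 2 :=
    le_trans (by nlinarith [mul_le_mul_of_nonneg_left hθj (mul_nonneg hc hCout)]) hsmall
  have hεA : 0 ≤ epsOfRecord ν (runFlow D g₀ K) j := eps_nonneg hA₀ ν.p₀ hA (hAγ.trans hγ1.le)
  have hεB : 0 ≤ epsOfRecord ν (runFlow D g₀ (K + 1)) (j + 1) := eps_nonneg hA₀ ν.p₀ hB (hBγ.trans hγ1.le)
  have h := abs_sub_le_two_mul_left hεA hεB hκ hκ2 hband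
  calc _ ≤ 2 * ((1 + ν.p₀ / Real.log (γ ^ 2)⁻¹) * γ ^ 2 * (Cout * θ₂ ^ j)) * epsOfRecord ν (runFlow D g₀ K) j := h
    _ = _ := by ring

/-- **THE THRESHOLD BAND RELATIVE TO RUN B's OWN THRESHOLD** (same hypotheses): `|ε(g^{(K)}_j) − ε(g^{(K+1)}_{j+1})| ≤ (2(1 + p₀∕log γ⁻²)γ²Cout)·θ₂^j·
ε(g^{(K+1)}_{j+1})`. [folklore] -/
theorem abs_epsOfRecord_runs_sub_le_mul_right_of_u2Output (ν : Stage7Numerics) (hA₀ : 0 ≤ ν.A₀) (D : FiniteEpsData F G) (g₀ : ℕ → ℝ)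
    {Cout θ₂ γ : ℝ} (hU2 : U2Output D g₀ Cout θ₂) (hθ0 : 0 ≤ θ₂) (hθ1 : θ₂ ≤ 1) (hγ1 : γ < 1)
    (hsmall : (1 + ν.p₀ / Real.log (γ ^ 2)⁻¹) * γ ^ 2 * Cout ≤ 1 / 2) {K j : ℕ} (hj : j ≤ K)
    (hA : 0 < runFlow D g₀ K j) (hAγ : runFlow D g₀ K j ≤ γ)
    (hB : 0 < runFlow D g₀ (K + 1) (j + 1)) (hBγ : runFlow D g₀ (K + 1) (j + 1) ≤ γ) :
    |epsOfRecord ν (runFlow D g₀ K) j - epsOfRecord ν (runFlow D g₀ (K + 1)) (j + 1)| ≤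
      (2 * ((1 + ν.p₀ / Real.log (γ ^ 2)⁻¹) * γ ^ 2 * Cout)) * θ₂ ^ j * epsOfRecord ν (runFlow D g₀ (K + 1)) (j + 1) := by
  have hband := abs_epsOfRecord_runs_sub_le_of_u2Output ν hA₀ D g₀ hU2 hγ1 hj hA hAγ hB hBγ
  have hγ : 0 < γ := lt_of_lt_of_le hA hAγ
  have hlogγ : 0 < Real.log (γ ^ 2)⁻¹ := Real.log_pos ((one_lt_inv₀ (by positivity)).mpr (by nlinarith))
  have hCout : 0 ≤ Cout := cout_nonneg_of_u2Output D g₀ hU2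
  have hc : 0 ≤ (1 + ν.p₀ / Real.log (γ ^ 2)⁻¹) * γ ^ 2 := by positivity
  have hθj : θ₂ ^ j ≤ 1 := pow_le_one₀ hθ0 hθ1
  have hκ : 0 ≤ (1 + ν.p₀ / Real.log (γ ^ 2)⁻¹) * γ ^ 2 * (Cout * θ₂ ^ j) := mul_nonneg hc (mul_nonneg hCout (pow_nonneg hθ0 j))
  have hκ2 : (1 + ν.p₀ / Real.log (γ ^ 2)⁻¹) * γ ^ 2 * (Cout * θ₂ ^ j) ≤ 1 / 2 :=
    le_trans (by nlinarith [mul_le_mul_of_nonneg_left hθj (mul_nonneg hc hCout)]) hsmall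
  have hεA : 0 ≤ epsOfRecord ν (runFlow D g₀ K) j := eps_nonneg hA₀ ν.p₀ hA (hAγ.trans hγ1.le)
  have hεB : 0 ≤ epsOfRecord ν (runFlow D g₀ (K + 1)) (j + 1) := eps_nonneg hA₀ ν.p₀ hB (hBγ.trans hγ1.le)
  have h := abs_sub_le_two_mul_right hεA hεB hκ hκ2 hband
  calc _ ≤ 2 * ((1 + ν.p₀ / Real.log (γ ^ 2)⁻¹) * γ ^ 2 * (Cout * θ₂ ^ j)) * epsOfRecord ν (runFlow D g₀ (K + 1)) (j + 1) := h
    _ = _ := by ring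

/-! ## §3 The threshold width family BY NAME from the [dict-thr] clause -/

/-- **THE THRESHOLD WIDTH FAMILY OF RUN A's LEDGER BY NAME.**  HYPOTHESES: node U2's output `U2Output D g₀ Cout θ₂` (`0 ≤ θ₂ ≤ 1`); the couplings of every tuned
run in the window, `∀ K i, i ≤ K → 0 < g^{(K)}_i ≤ γ` (`Spine.NE4.box_and_pin_of_tuned`), `γ < 1`; `0 ≤ ν.A₀`; the window smallness; a level-width sequence `τ`
and the [dict-thr] clause «for every `j`, `τ j` is at most EVERY `x` with `|ε(g^{(K)}_j) − ε(g^{(K+1)}_{j+1})| ≤ x·ε(g^{(K)}_j)` for all `K ≥ j`» (the ledger's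
threshold widths are read against run A's thresholds of record along the matched runs).  CONCLUSION: `∀ j, τ j ≤ (2(1 + p₀∕log γ⁻²)γ²Cout)·θ₂^j` — module 5's
`hτA`. [folklore] -/
theorem thresholdRate_left_of_u2Output (ν : Stage7Numerics) (hA₀ : 0 ≤ ν.A₀) (D : FiniteEpsData F G) (g₀ : ℕ → ℝ)
    {Cout θ₂ γ : ℝ} (hU2 : U2Output D g₀ Cout θ₂) (hθ0 : 0 ≤ θ₂) (hθ1 : θ₂ ≤ 1) (hγ1 : γ < 1)
    (hwin : ∀ K i, i ≤ K → 0 < runFlow D g₀ K i ∧ runFlow D g₀ K i ≤ γ)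
    (hsmall : (1 + ν.p₀ / Real.log (γ ^ 2)⁻¹) * γ ^ 2 * Cout ≤ 1 / 2) {τ : ℕ → ℝ}
    (hdict : ∀ j, ∀ x : ℝ, (∀ K, j ≤ K →
      |epsOfRecord ν (runFlow D g₀ K) j - epsOfRecord ν (runFlow D g₀ (K + 1)) (j + 1)| ≤ x * epsOfRecord ν (runFlow D g₀ K) j) → τ j ≤ x) :
    ∀ j, τ j ≤ (2 * ((1 + ν.p₀ / Real.log (γ ^ 2)⁻¹) * γ ^ 2 * Cout)) * θ₂ ^ j := fun j =>
  hdict j _ fun K hjK =>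
    abs_epsOfRecord_runs_sub_le_mul_left_of_u2Output ν hA₀ D g₀ hU2 hθ0 hθ1 hγ1 hsmall hjK (hwin K j hjK).1 (hwin K j hjK).2
      (hwin (K + 1) (j + 1) (Nat.succ_le_succ hjK)).1 (hwin (K + 1) (j + 1) (Nat.succ_le_succ hjK)).2

/-- **THE THRESHOLD WIDTH FAMILY OF RUN B's LEDGER BY NAME** (read against run B's OWN thresholds `ε(g^{(K+1)}_{j+1})`): `∀ j, τ j ≤ (2(1 + p₀∕log γ⁻²)γ²Cout)
·θ₂^j` — module 5's `hτB`. [folklore] -/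
theorem thresholdRate_right_of_u2Output (ν : Stage7Numerics) (hA₀ : 0 ≤ ν.A₀) (D : FiniteEpsData F G) (g₀ : ℕ → ℝ)
    {Cout θ₂ γ : ℝ} (hU2 : U2Output D g₀ Cout θ₂) (hθ0 : 0 ≤ θ₂) (hθ1 : θ₂ ≤ 1) (hγ1 : γ < 1)
    (hwin : ∀ K i, i ≤ K → 0 < runFlow D g₀ K i ∧ runFlow D g₀ K i ≤ γ)
    (hsmall : (1 + ν.p₀ / Real.log (γ ^ 2)⁻¹) * γ ^ 2 * Cout ≤ 1 / 2) {τ : ℕ → ℝ}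
    (hdict : ∀ j, ∀ x : ℝ, (∀ K, j ≤ K →
      |epsOfRecord ν (runFlow D g₀ K) j - epsOfRecord ν (runFlow D g₀ (K + 1)) (j + 1)| ≤ x * epsOfRecord ν (runFlow D g₀ (K + 1)) (j + 1)) →
      τ j ≤ x) :
    ∀ j, τ j ≤ (2 * ((1 + ν.p₀ / Real.log (γ ^ 2)⁻¹) * γ ^ 2 * Cout)) * θ₂ ^ j := fun j =>
  hdict j _ fun K hjK =>
    abs_epsOfRecord_runs_sub_le_mul_right_of_u2Output ν hA₀ D g₀ hU2 hθ0 hθ1 hγ1 hsmall hjK (hwin K j hjK).1 (hwin K j hjK).2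
      (hwin (K + 1) (j + 1) (Nat.succ_le_succ hjK)).1 (hwin (K + 1) (j + 1) (Nat.succ_le_succ hjK)).2

/-! ## §4 NE7c at explicit carriers with BOTH width families by name (N16 at the layers + node U2) -/

/-- **NE7c's `ShellWeightBound` AT EXPLICIT CARRIERS, BOTH WIDTH FAMILIES BY NAME.**  Module 5's `shellWeightBound_geometric_of_ne3Layers` with its threshold-width
inputs DISCHARGED from node U2: DATA = explicit carriers `(l₀, T, A, B, shA, shB)` with the two runs' LEVEL LEDGERS ([dict] + (M1); widths `ρA, ρB`, threshold
parts `τA, τB`), LIVE WINDOWS (N20), `D ≤ D̄` (N12); N16's record decl `h16 : ∀ K, N16At (ne3OfRecord₁₁ F (o K))` at the home's NE3 layers with run-length-uniform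
END letters, the family base `θ` and the two [dict] clauses (module 5 §3); node U2's `U2Output D g₀ Cout θ₂` (`0 ≤ θ₂ < 1`) at a datum `D` with the couplings of
its tuned runs in `(0, γ]`, `γ < 1`, numerics `0 ≤ ν.A₀`, the window smallness `(1 + p₀∕log γ⁻²)γ²Cout ≤ 1∕2`, and the two [dict-thr] clauses (§3).  CONCLUSION:
`∃ C ≥ 0`, `ShellWeightBound l₀ T A B shA shB (K ↦ C·(θ ∨ θ₂)^K)`.  CONDITIONAL on every displayed binder; NE7c NOT proved; N21 NOT discharged. [folklore] -/
theorem shellWeightBound_geometric_of_ne3Layers_u2Output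
    -- N16 at the home's NE3 layers (module 5 §3's inputs)
    {F : T4Family} {o : ℕ → NE3Objects₁₁ N} (h16 : ∀ K, N16At (ne3OfRecord₁₁ F (o K)))
    {θ γE l₁ Λbar ε' cg : ℝ} (hθ : 0 < θ) (hθ1 : θ < 1) (hθ6 : θ ^ 6 = ((F.L : ℝ))⁻¹)
    (hN : ∀ K, 1 ≤ (o K).Nper) (hb : ∀ K, 0 ≤ (o K).b) (hbs : ∀ K, 512 * (4 + 1) * (4 + 4) * (F.L : ℝ) ^ 2 * (o K).b ≤ 1)
    (hg : ∀ K, 0 ≤ (o K).g) (hC : ∀ K, 0 ≤ (o K).C) (hΛ₂' : ∀ K, 0 < (o K).Λ₂') (hΛbar : ∀ K, (o K).Λ₂' ≤ Λbar) (hγE : 0 < γE)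
    (hγ3 : ∀ K, (o K).C * (wallConst 4 F.L * ((o K).Nper : ℝ) ^ 2 *
      (Real.sqrt (o K).g * dualC2 4 F.L + 2 * (o K).b ^ 2 * dualC1 4 F.L)) ≤ γE ^ 3)
    (hl₁ : 0 < l₁) (hΛl₁ : ∀ K, (o K).Λ₁ ≤ l₁ ^ 3) (hε' : 0 < ε') (hcg : 0 ≤ cg)
    -- node U2 at the datum (this module's inputs)
    (ν : Stage7Numerics) (hA₀ : 0 ≤ ν.A₀) (D : FiniteEpsData F G) (g₀ : ℕ → ℝ) {Cout θ₂ γ : ℝ} (hU2 : U2Output D g₀ Cout θ₂)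
    (h₂ : 0 ≤ θ₂) (h₂' : θ₂ < 1) (hγ1 : γ < 1) (hwin : ∀ K i, i ≤ K → 0 < runFlow D g₀ K i ∧ runFlow D g₀ K i ≤ γ)
    (hsmall : (1 + ν.p₀ / Real.log (γ ^ 2)⁻¹) * γ ^ 2 * Cout ≤ 1 / 2)
    -- the explicit carriers, the two level ledgers, the live windows, `D ≤ D̄`
    {ι σA σB : Type*} {l₀ : ℝ} {T : ℕ → Finset ι} {A B shA shB : ℕ → ℝ → ι → ℝ}
    {SA : ℕ → Finset σA} {SB : ℕ → Finset σB} {pieceA : ℕ → ℝ → σA → ι → ℝ} {pieceB : ℕ → ℝ → σB → ι → ℝ}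
    {lvlA : ℕ → σA → ℕ} {lvlB : ℕ → σB → ℕ} {DA ρA DB ρB τA τB : ℕ → ℝ} {N₁ : ℕ} {νbar Dbar : ℝ}
    (hLA : LevelLedger l₀ T A shA SA pieceA lvlA DA ρA) (hLB : LevelLedger l₀ T B shB SB pieceB lvlB DB ρB)
    (hwA : LiveWindow SA lvlA N₁ νbar) (hwB : LiveWindow SB lvlB N₁ νbar) (hDA : ∀ j, DA j ≤ Dbar) (hDB : ∀ j, DB j ≤ Dbar)
    -- the [dict] clauses (variable widths against the home's minimiser pairs, module 5) and the [dict-thr] clauses (threshold widths, §3)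
    (hdictA : ∀ j, 1 ≤ j → ∀ x : ℝ,
      (∀ (K : ℕ) (V UA UB : B7Prop1Explicit.Site 4 → Fin 4 → (Matrix (Fin N) (Fin N) ℂ)ˣ) (z : B7Prop1Explicit.Site 4) (μ ν : Fin 4) (t : ℝ),
        V ∈ (o K).dom → IsMinimiser 4 (sfClass 4 F.L (o K).Nper (o K).ε) F.L (o K).Nper j V UA →
        IsMinimiser 4 (sfClass 4 F.L (o K).Nper (o K).ε) F.L (o K).Nper (j + 1) V UB → Regular 4 F.L (o K).Nper (o K).b (o K).g (j + 1) UB →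
        ε' * ((F.L : ℝ)⁻¹) ^ (2 * j) ≤ t →
        |‖((hol UA z (plaqWord μ ν) : (Matrix (Fin N) (Fin N) ℂ)ˣ) : Matrix (Fin N) (Fin N) ℂ) - 1‖
            - ‖((hol (rescale F.L (bavg F.L UB)) z (plaqWord μ ν) : (Matrix (Fin N) (Fin N) ℂ)ˣ) : Matrix (Fin N) (Fin N) ℂ) - 1‖| / t ≤ x) →
      ρA j ≤ x + τA j)
    (hdictB : ∀ j, 1 ≤ j → ∀ x : ℝ,
      (∀ (K : ℕ) (V UA UB : B7Prop1Explicit.Site 4 → Fin 4 → (Matrix (Fin N) (Fin N) ℂ)ˣ) (z : B7Prop1Explicit.Site 4) (π : Plane 4)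
        (r₀ : Fin 4 → Fin F.L) (i₀ j₀ : ℕ) (t : ℝ),
        V ∈ (o K).dom → IsMinimiser 4 (sfClass 4 F.L (o K).Nper (o K).ε) F.L (o K).Nper j V UA →
        IsMinimiser 4 (sfClass 4 F.L (o K).Nper (o K).ε) F.L (o K).Nper (j + 1) V UB → Regular 4 F.L (o K).Nper (o K).b (o K).g (j + 1) UB →
        RegularSup 4 F.L (o K).Nper (o K).b cg (j + 1) UB → i₀ < F.L → j₀ < F.L → ε' * ((F.L : ℝ)⁻¹) ^ (2 * j) ≤ t →
        |‖((hol UA z (plaqWord π.1.1 π.1.2) : (Matrix (Fin N) (Fin N) ℂ)ˣ) : Matrix (Fin N) (Fin N) ℂ) - 1‖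
            - (F.L : ℝ) ^ 2 * ‖((hol UB ((F.L : ℤ) • z + boxVec F.L r₀ + (i₀ : ℤ) • e π.1.1 + (j₀ : ℤ) • e π.1.2)
                (plaqWord π.1.1 π.1.2) : (Matrix (Fin N) (Fin N) ℂ)ˣ) : Matrix (Fin N) (Fin N) ℂ) - 1‖| / t ≤ x) →
      ρB j ≤ x + τB j)
    (hthrA : ∀ j, ∀ x : ℝ, (∀ K, j ≤ K →
      |epsOfRecord ν (runFlow D g₀ K) j - epsOfRecord ν (runFlow D g₀ (K + 1)) (j + 1)| ≤ x * epsOfRecord ν (runFlow D g₀ K) j) → τA j ≤ x)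
    (hthrB : ∀ j, ∀ x : ℝ, (∀ K, j ≤ K →
      |epsOfRecord ν (runFlow D g₀ K) j - epsOfRecord ν (runFlow D g₀ (K + 1)) (j + 1)| ≤ x * epsOfRecord ν (runFlow D g₀ (K + 1)) (j + 1)) →
      τB j ≤ x) :
    ∃ C : ℝ, 0 ≤ C ∧ ShellWeightBound l₀ T A B shA shB fun K => C * max θ θ₂ ^ K := by
  have hγ : 0 < γ := lt_of_lt_of_le (hwin 0 0 le_rfl).1 (hwin 0 0 le_rfl).2
  have hlogγ : 0 < Real.log (γ ^ 2)⁻¹ := Real.log_pos ((one_lt_inv₀ (by positivity)).mpr (by nlinarith))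
  have hCout : 0 ≤ Cout := cout_nonneg_of_u2Output D g₀ hU2
  have hc₂ : 0 ≤ 2 * ((1 + ν.p₀ / Real.log (γ ^ 2)⁻¹) * γ ^ 2 * Cout) := by positivity
  exact shellWeightBound_geometric_of_ne3Layers h16 hθ hθ1 hθ6 hN hb hbs hg hC hΛ₂' hΛbar hγE hγ3 hl₁ hΛl₁ hε' hcg hLA hLB hwA hwB hDA hDB hc₂ h₂ h₂'
    (thresholdRate_left_of_u2Output ν hA₀ D g₀ hU2 h₂ h₂'.le hγ1 hwin hsmall hthrA)
    (thresholdRate_right_of_u2Output ν hA₀ D g₀ hU2 h₂ h₂'.le hγ1 hwin hsmall hthrB) hdictA hdictB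

/-! ## §5 At ANY keyed rate home BY NAME: `S_N16 RRec` (home attaining the reading's literals) + `U2Output` along a TUNED sequence -/

/-- **NE7c AT EXPLICIT CARRIERS FROM THE K4 STUB `S_N16 RRec` AND NODE U2's OUTPUT ALONG A TUNED SEQUENCE.**  §4 at the NE3 layers `K ↦ ne3At h g₀ os K` of a
key-indexed reading at ANY keyed home `RRec` that ATTAINS its literals (module 5 §5's shape; `covRoot_of_attains`), with the window clause supplied BY NAME from
`D.Tuned γ g g₀` (`Spine.NE4.box_and_pin_of_tuned`).  Every other binder displayed as in §4.  CONDITIONAL; NE7c NOT proved; N21 NOT discharged. [folklore] -/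
theorem shellWeightBound_geometric_of_attains_u2Output
    {key : (F : T4Family) → YMDAG.UVSplit.Datum F N → Prop}
    (ne3At : ∀ {F : T4Family} {D : YMDAG.UVSplit.Datum F N}, key F D → (ℕ → ℝ) → List (ULoop F) → ℕ → NE3Objects₁₁ N)
    (RRec : YMDAG.UVSplit.RateRecordPred N)
    (hatt : ∀ (F : T4Family) (D : YMDAG.UVSplit.Datum F N) (h : key F D) (g₀ : ℕ → ℝ) (os : List (ULoop F)) (k : ℕ),
      ∃ R : YMDAG.UVSplit.RateCarriers N, RRec F D g₀ os R ∧ R.ne3 = ne3OfRecord₁₁ F (ne3At h g₀ os k))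
    (hS : YMDAG.UVSplit.S_N16 RRec) {F : T4Family} {D : YMDAG.UVSplit.Datum F N} (h : key F D) (g₀ : ℕ → ℝ) (os : List (ULoop F))
    {θ γE l₁ Λbar ε' cg : ℝ} (hθ : 0 < θ) (hθ1 : θ < 1) (hθ6 : θ ^ 6 = ((F.L : ℝ))⁻¹)
    (hN : ∀ K, 1 ≤ (ne3At h g₀ os K).Nper) (hb : ∀ K, 0 ≤ (ne3At h g₀ os K).b)
    (hbs : ∀ K, 512 * (4 + 1) * (4 + 4) * (F.L : ℝ) ^ 2 * (ne3At h g₀ os K).b ≤ 1)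
    (hg : ∀ K, 0 ≤ (ne3At h g₀ os K).g) (hC : ∀ K, 0 ≤ (ne3At h g₀ os K).C) (hΛ₂' : ∀ K, 0 < (ne3At h g₀ os K).Λ₂')
    (hΛbar : ∀ K, (ne3At h g₀ os K).Λ₂' ≤ Λbar) (hγE : 0 < γE)
    (hγ3 : ∀ K, (ne3At h g₀ os K).C * (wallConst 4 F.L * ((ne3At h g₀ os K).Nper : ℝ) ^ 2 *
      (Real.sqrt (ne3At h g₀ os K).g * dualC2 4 F.L + 2 * (ne3At h g₀ os K).b ^ 2 * dualC1 4 F.L)) ≤ γE ^ 3)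
    (hl₁ : 0 < l₁) (hΛl₁ : ∀ K, (ne3At h g₀ os K).Λ₁ ≤ l₁ ^ 3) (hε' : 0 < ε') (hcg : 0 ≤ cg)
    (ν : Stage7Numerics) (hA₀ : 0 ≤ ν.A₀) {Cout θ₂ γ g : ℝ} (hU2 : U2Output D g₀ Cout θ₂) (h₂ : 0 ≤ θ₂) (h₂' : θ₂ < 1) (hγ1 : γ < 1)
    (ht : D.Tuned γ g g₀) (hsmall : (1 + ν.p₀ / Real.log (γ ^ 2)⁻¹) * γ ^ 2 * Cout ≤ 1 / 2)
    {ι σA σB : Type*} {l₀ : ℝ} {T : ℕ → Finset ι} {A B shA shB : ℕ → ℝ → ι → ℝ}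
    {SA : ℕ → Finset σA} {SB : ℕ → Finset σB} {pieceA : ℕ → ℝ → σA → ι → ℝ} {pieceB : ℕ → ℝ → σB → ι → ℝ}
    {lvlA : ℕ → σA → ℕ} {lvlB : ℕ → σB → ℕ} {DA ρA DB ρB τA τB : ℕ → ℝ} {N₁ : ℕ} {νbar Dbar : ℝ}
    (hLA : LevelLedger l₀ T A shA SA pieceA lvlA DA ρA) (hLB : LevelLedger l₀ T B shB SB pieceB lvlB DB ρB)
    (hwA : LiveWindow SA lvlA N₁ νbar) (hwB : LiveWindow SB lvlB N₁ νbar) (hDA : ∀ j, DA j ≤ Dbar) (hDB : ∀ j, DB j ≤ Dbar)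
    (hdictA : ∀ j, 1 ≤ j → ∀ x : ℝ,
      (∀ (K : ℕ) (V UA UB : B7Prop1Explicit.Site 4 → Fin 4 → (Matrix (Fin N) (Fin N) ℂ)ˣ) (z : B7Prop1Explicit.Site 4) (μ ν : Fin 4) (t : ℝ),
        V ∈ (ne3At h g₀ os K).dom →
        IsMinimiser 4 (sfClass 4 F.L (ne3At h g₀ os K).Nper (ne3At h g₀ os K).ε) F.L (ne3At h g₀ os K).Nper j V UA →
        IsMinimiser 4 (sfClass 4 F.L (ne3At h g₀ os K).Nper (ne3At h g₀ os K).ε) F.L (ne3At h g₀ os K).Nper (j + 1) V UB →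
        Regular 4 F.L (ne3At h g₀ os K).Nper (ne3At h g₀ os K).b (ne3At h g₀ os K).g (j + 1) UB → ε' * ((F.L : ℝ)⁻¹) ^ (2 * j) ≤ t →
        |‖((hol UA z (plaqWord μ ν) : (Matrix (Fin N) (Fin N) ℂ)ˣ) : Matrix (Fin N) (Fin N) ℂ) - 1‖
            - ‖((hol (rescale F.L (bavg F.L UB)) z (plaqWord μ ν) : (Matrix (Fin N) (Fin N) ℂ)ˣ) : Matrix (Fin N) (Fin N) ℂ) - 1‖| / t ≤ x) →
      ρA j ≤ x + τA j)
    (hdictB : ∀ j, 1 ≤ j → ∀ x : ℝ,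
      (∀ (K : ℕ) (V UA UB : B7Prop1Explicit.Site 4 → Fin 4 → (Matrix (Fin N) (Fin N) ℂ)ˣ) (z : B7Prop1Explicit.Site 4) (π : Plane 4)
        (r₀ : Fin 4 → Fin F.L) (i₀ j₀ : ℕ) (t : ℝ),
        V ∈ (ne3At h g₀ os K).dom →
        IsMinimiser 4 (sfClass 4 F.L (ne3At h g₀ os K).Nper (ne3At h g₀ os K).ε) F.L (ne3At h g₀ os K).Nper j V UA →
        IsMinimiser 4 (sfClass 4 F.L (ne3At h g₀ os K).Nper (ne3At h g₀ os K).ε) F.L (ne3At h g₀ os K).Nper (j + 1) V UB →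
        Regular 4 F.L (ne3At h g₀ os K).Nper (ne3At h g₀ os K).b (ne3At h g₀ os K).g (j + 1) UB →
        RegularSup 4 F.L (ne3At h g₀ os K).Nper (ne3At h g₀ os K).b cg (j + 1) UB → i₀ < F.L → j₀ < F.L →
        ε' * ((F.L : ℝ)⁻¹) ^ (2 * j) ≤ t →
        |‖((hol UA z (plaqWord π.1.1 π.1.2) : (Matrix (Fin N) (Fin N) ℂ)ˣ) : Matrix (Fin N) (Fin N) ℂ) - 1‖
            - (F.L : ℝ) ^ 2 * ‖((hol UB ((F.L : ℤ) • z + boxVec F.L r₀ + (i₀ : ℤ) • e π.1.1 + (j₀ : ℤ) • e π.1.2)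
                (plaqWord π.1.1 π.1.2) : (Matrix (Fin N) (Fin N) ℂ)ˣ) : Matrix (Fin N) (Fin N) ℂ) - 1‖| / t ≤ x) →
      ρB j ≤ x + τB j)
    (hthrA : ∀ j, ∀ x : ℝ, (∀ K, j ≤ K →
      |epsOfRecord ν (runFlow D g₀ K) j - epsOfRecord ν (runFlow D g₀ (K + 1)) (j + 1)| ≤ x * epsOfRecord ν (runFlow D g₀ K) j) → τA j ≤ x)
    (hthrB : ∀ j, ∀ x : ℝ, (∀ K, j ≤ K →
      |epsOfRecord ν (runFlow D g₀ K) j - epsOfRecord ν (runFlow D g₀ (K + 1)) (j + 1)| ≤ x * epsOfRecord ν (runFlow D g₀ (K + 1)) (j + 1)) →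
      τB j ≤ x) :
    ∃ C : ℝ, 0 ≤ C ∧ ShellWeightBound l₀ T A B shA shB fun K => C * max θ θ₂ ^ K :=
  shellWeightBound_geometric_of_ne3Layers_u2Output (o := fun K => ne3At h g₀ os K)
    (fun K => (N16AtRRec11.n16At_ne3OfRecord₁₁_iff F _).2 (N16AtKeyedHome.covRoot_of_attains ne3At RRec hatt hS F D h g₀ os K))
    hθ hθ1 hθ6 hN hb hbs hg hC hΛ₂' hΛbar hγE hγ3 hl₁ hΛl₁ hε' hcg ν hA₀ D g₀ hU2 h₂ h₂' hγ1 (Spine.NE4.box_and_pin_of_tuned D ht).1 hsmall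
    hLA hLB hwA hwB hDA hDB hdictA hdictB hthrA hthrB

end U2

end Summit.QuantumFields.YangMills.Theorems.N21AtKeyedRateHomeU2

end
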